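import Summits.RiemannHypothesis.RiemannHypothesis.Theses.ShiftedResolvent
import Literature.NumberTheory.LFunctions.WeilResolventVector
import Literature.NumberTheory.LFunctions.WeilWindowSuzukiProofs
import Literature.NumberTheory.LFunctions.WeilFirstPrimePositivityTwoFifths

/-!
# Crux `ShiftedResolvent.ResolventRealZeros` (item stmt-RiemannHypothesis-15969) AS TYPED is false

Skeleton-registrar diagnostic (planner-skel-stmt-RiemannHypothesis-15969-0, 2026-08-17).

PARSE TRAP (evidence `shifted-resolvent-parse-trap.md` on the item, by
literature-prover-defn-IsWeilResolventVector-0; tree lemma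
`Literature.NumberTheory.LFunctions.weilResolventFunctional_ne_parse`, `rfl`): in the inline
hypothesis of the crux the text
`(weilQuadratic h).re - lam * ∫ t, ‖h t‖ ^ 2 - 2 * (weilMellin h (1 / 2)).re`
parses as `(weilQuadratic h).re - lam * ∫ t, (‖h t‖ ^ 2 - 2 * (weilMellin h (1 / 2)).re)`:
the `∫` binder (body at precedence 60) swallows the linear term `- 2 Re ĥ(1/2)` of the Dirichlet
functional. Consequence, kernel-checked below: at the shift `lam = 0` the mis-parsed functional is
`J'(h) = Re Q(h)`, so on any Weil-positive window `[-a, a]` with `0 < ε(a)` (tree: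
`exists_weilGroundEnergy_pos`, `weilPositivityOn_of_le_two_fifths`) the zero function `v = 0`
(minimising sequence `gₙ = 0`, `m = 0`) satisfies the hypothesis, while the conclusion
`∀ s, weilMellin 0 s = 0 → s.re = 1/2` fails at `s = 0`. Hence `¬ ResolventRealZeros` for the
decl exactly as rendered in `Theses/ShiftedResolvent.lean` rev 2, and NO honest skeleton
`stub₁ → … → ResolventRealZeros` exists (some stub would have to be false).

REPAIR (for the tenure / route-repair planner, not done here): restate the crux over the landed,
correctly parenthesised predicate `Literature.NumberTheory.LFunctions.IsWeilResolventVector a lam v`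
(WeilResolventVector.lean rev 1; `isWeilResolventVector_iff` is `Iff.rfl` with the parenthesised
inline text) — see `ResolventRealZerosR` in `Lines/birth_repaired.lean` of this crux directory —
and likewise items 15968 (ResolventConvergence) and 15970 (ResolventVectorExists), whose inline
IsRes text carries the same trap.
-/

open MeasureTheory Filter Set
open scoped Topology

namespace Summit.RiemannHypothesis.RiemannHypothesis.Cruxes.ResolventRealZeros.Birth

open _root_.Literature.NumberTheory.LFunctions
open Summit.RiemannHypothesis.RiemannHypothesis.Theses.ShiftedResolvent

/-- The hypothesis of the crux exactly AS TYPED (token for token the inline `IsRes` text of the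
route file, parse trap included), named. -/
def IsResTyped (a lam : ℝ) (v : ℝ → ℂ) : Prop :=
  MemLp v 2 ∧ ∃ g : ℕ → ℝ → ℂ, (∀ n, IsWeilTest (g n) ∧ tsupport (g n) ⊆ Icc (-a) a) ∧ (∃ m : ℝ, (∀ h : ℝ → ℂ, IsWeilTest h → tsupport h ⊆ Icc (-a) a → m ≤ (weilQuadratic h).re - lam * ∫ t, ‖h t‖ ^ 2 - 2 * (weilMellin h (1 / 2)).re) ∧ Tendsto (fun n => (weilQuadratic (g n)).re - lam * ∫ t, ‖g n t‖ ^ 2 - 2 * (weilMellin (g n) (1 / 2)).re) atTop (𝓝 m)) ∧ Tendsto (fun n => ∫ t, ‖g n t - v t‖ ^ 2) atTop (𝓝 0)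

/-- Read-back: the route decl is `∀ a > 0, ∀ lam < ε(a), ∀ v, IsResTyped a lam v → …`
(definitional). -/
theorem resolventRealZeros_iff :
    ResolventRealZeros ↔
      ∀ a : ℝ, 0 < a → ∀ lam : ℝ, lam < weilGroundEnergy a → ∀ v : ℝ → ℂ, IsResTyped a lam v →
        Differentiable ℂ (weilMellin v) ∧ ∀ s : ℂ, weilMellin v s = 0 → s.re = 1 / 2 :=
  Iff.rfl

/-- The parse trap, instantiated: the lower-bound clause of `IsResTyped` compares `m` with
`Re Q(h) − lam · ∫ (‖h t‖² − 2 Re ĥ(1/2)) dt`, NOT with the Dirichlet functional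
`weilResolventFunctional lam h = Re Q(h) − lam ∫ ‖h‖² − 2 Re ĥ(1/2)`. -/
theorem isResTyped_clause_eq (lam : ℝ) (h : ℝ → ℂ) :
    ((weilQuadratic h).re - lam * ∫ t, ‖h t‖ ^ 2 - 2 * (weilMellin h (1 / 2)).re) =
      (weilQuadratic h).re - lam * ∫ t, (‖h t‖ ^ 2 - 2 * (weilMellin h (1 / 2)).re) :=
  rfl

/-- WITNESS: on a Weil-positive window, at the admissible shift `lam = 0`, the ZERO function
satisfies the typed hypothesis (minimising sequence `gₙ = 0`, infimum `m = 0`). -/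
theorem isResTyped_zero {a : ℝ} (hpos : WeilPositivityOn a) : IsResTyped a 0 0 := by
  refine ⟨MemLp.zero, fun _ => 0, fun _ => ⟨isWeilTest_zero, ?_⟩, ⟨0, ?_, ?_⟩, ?_⟩
  · intro t ht
    simp [tsupport] at ht
  · intro h hh hsupp
    simpa using hpos h hh hsupp
  · exact tendsto_const_nhds.congr fun n => by simp [weilQuadratic_zero]
  · exact tendsto_const_nhds.congr fun n => by simp

/-- **The crux as typed is false.** Window `a = min a₁ (2/5)`: `0 < ε(a)`
(`exists_weilGroundEnergy_pos`) and `WeilPositivityOn a` (`weilPositivityOn_of_le_two_fifths`);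
shift `lam = 0 < ε(a)`; vector `v = 0` (`isResTyped_zero`); but `weilMellin 0 0 = 0` and
`(0 : ℂ).re ≠ 1/2`. -/
theorem not_resolventRealZeros : ¬ ResolventRealZeros := by
  intro h
  obtain ⟨a₁, ha₁, H⟩ := exists_weilGroundEnergy_pos
  have ha0 : 0 < min a₁ (2 / 5) := lt_min ha₁ (by norm_num)
  have hε : (0 : ℝ) < weilGroundEnergy (min a₁ (2 / 5)) := H _ ha0 (min_le_left _ _)
  have hW : WeilPositivityOn (min a₁ (2 / 5)) := weilPositivityOn_of_le_two_fifths (min_le_right _ _)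
  have hres := (resolventRealZeros_iff.1 h) _ ha0 0 hε 0 (isResTyped_zero hW)
  have h0 : ((0 : ℂ)).re = 1 / 2 := hres.2 0 (by simp)
  norm_num at h0

end Summit.RiemannHypothesis.RiemannHypothesis.Cruxes.ResolventRealZeros.Birth
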